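import Summits.BirchSwinnertonDyer.BirchSwinnertonDyer.Theorems.ManinLocalTwoThreeTameThreeNeronScalarIIIstar
import Summits.BirchSwinnertonDyer.BirchSwinnertonDyer.Theorems.ManinLocalTwoThreeThirdLatticeVelu
import Literature.NumberTheory.EllipticCurves.ManinConstantGamma1Gamma0LedgerProofs
import HarnessLib

/-!
# No tripling on the `III*` stratum: at `N = 9p` (`p ≡ 2 (mod 3)`) an `X₀`-optimal curve of potentially good type `III*`
# at `3` has `|c₀| = |c₁|` — UNCONDITIONALLY (the an planner's edge `notTripled_nineMulPrime_of_typeIIIstar`, input discharged)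

Summit `BirchSwinnertonDyer`, route `ManinLocalTwoThree` (cell bsd-f2-manin), crux C3 `ManinPrimeToThreeAtNine`
(stmt-BirchSwinnertonDyer-22968); the `3`-adic Γ₀/Γ₁ ledger (p629489 `c₁ ∣ c₀ ∣ 3c₁` at `9 ∣ N`; p3-g6 Vélu rigidity
`velu_three_of_tripled_nine_mul_prime`: at `N = 9p`, `p ≡ 2 (mod 3)`, TRIPLING `|c₀| = 3|c₁|` forces the globally minimal `W₁`
to carry the `u = 1` Vélu pair of `W₀` at a rational `3`-line) COMPOSED with the local law of the sibling file
(`not_exists_isGloballyMinimal_velu_three_of_IIIstar`: on a tame pot.-good `III*` curve the `u = 1` Vélu pair is never a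
minimal pair).  Results, for the optimal `X₁(9p)`/`X₀(9p)` pair `(D₁, D₀)` of a class whose `X₀`-optimal curve `W₀` is
TAME at `3` with `ord₃ Δ_min = 9`, `ord₃ j ≥ 0`:

* `natAbs_maninConstant₀_ne_three_mul_of_IIIstar_nine_mul_prime` — `|c₀| ≠ 3|c₁|` (MEMO-an §66 (a), now unconditional);
* `natAbs_maninConstant₀_eq_of_IIIstar_nine_mul_prime` — hence `|c₀| = |c₁|` (ledger dichotomy);
* `dvd_maninConstant₀_iff_of_IIIstar_nine_mul_prime` / `not_three_dvd_…` — `ℓ ∣ c₀ ⟺ ℓ ∣ c₁`; C3 for `D₀` ⟺ `3 ∤ c₁`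
  (Stevens' form) on this stratum;
* `…_of_level` variants: with the Modularity Theorem `exists_isNewformOf` (the crux's fourth hypothesis) the tameness
  hypotheses `9 ∥ N(W₀)` are read off the level `9p` (`IsNewformOf.level_eq_conductorNorm_of_exists_isNewformOf`).

HONEST FRAMING: no Manin constant is shown prime to `3`; C3, Manin's conjecture and BSD are not proved.  No definitions.
References: [CesnaviciusNeururerSaha2023] Lemma 6.5; [LingOesterle1991] Thm. 6; [Stevens1989] (5.2)–(5.4); cell memo
HOME/MEMO-an.md §66, Sketch-an-g24.lean (edge `notTripled_nineMulPrime_of_typeIIIstar`).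
-/

set_option autoImplicit false
-- the summit-side namespace `Summit.BirchSwinnertonDyer.BirchSwinnertonDyer.…` is the tree's (summit = sub-problem)
set_option linter.dupNamespace false

noncomputable section

open WeierstrassCurve Literature.NumberTheory.EllipticCurves Literature.NumberTheory.EllipticCurves.ModularForms
open CongruenceSubgroup Polynomial

namespace Summit.BirchSwinnertonDyer.BirchSwinnertonDyer.Theorems.ManinLocalTwoThree

variable {W₁ W₀ : WeierstrassCurve ℚ} [W₁.IsElliptic] [W₁.IsGloballyMinimal] [W₀.IsElliptic]
  [W₀.IsGloballyMinimal]

/-- **NO TRIPLING ON THE `III*` STRATUM AT `N = 9p`.**  For `p` prime, `p ≡ 2 (mod 3)`, the optimal `X₁(9p)`-datum `D₁`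
(on the globally minimal `W₁`) and a lattice-optimal `X₀(9p)`-datum `D₀` (on the globally minimal `W₀`) of one isogeny
class, with `W₀` tame at `3` (`9 ∥ N(W₀)`), `ord₃ Δ_min(W₀) = 9` and `ord₃ j(W₀) ≥ 0` (pot.-good `III*`):
`|c₀| ≠ 3|c₁|`.  (p3-g6 `velu_three_of_tripled_nine_mul_prime` + `not_exists_isGloballyMinimal_velu_three_of_IIIstar`.)
[cite: CesnaviciusNeururerSaha2023, Lemma 6.5] [cite: SilvermanATAEC1994, IV.9.4 Table 4.1] -/
theorem natAbs_maninConstant₀_ne_three_mul_of_IIIstar_nine_mul_prime {p : ℕ} (hp : p.Prime) (hp3 : p % 3 = 2)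
    [NeZero (9 * p)] (D₁ : Gamma1ParametrizationData W₁ (9 * p)) (D₀ : ModularParametrizationData W₀ (9 * p))
    (hiso : IsIsogenous W₁ W₀) (h₁ : D₁.IsOptimal)
    (h₀ : ∀ z ∈ D₀.L.lattice, ∃ w ∈ periodLattice D₀.f, z = D₀.c * w)
    (h9 : 3 ^ 2 ∣ W₀.conductorNorm ℤ) (h27 : ¬ 3 ^ 3 ∣ W₀.conductorNorm ℤ)
    (hΔ : padicValInt 3 W₀.minimalDiscriminantInt = 9) (hj : 0 ≤ padicValRat 3 W₀.j) :
    D₀.maninConstant.natAbs ≠ 3 * D₁.maninConstant.natAbs := by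
  intro htri
  obtain ⟨q, hq, h4, h6⟩ := velu_three_of_tripled_nine_mul_prime hp hp3 D₁ D₀ hiso h₁ h₀ htri
  exact not_exists_isGloballyMinimal_velu_three_of_IIIstar W₀ h9 h27 hΔ hj q hq ⟨W₁, ‹_›, ‹_›, h4, h6⟩

/-- **`|c₀| = |c₁|` on the `III*` stratum at `N = 9p`** (`p ≡ 2 (mod 3)`): the ledger dichotomy `|c₀| ∈ {|c₁|, 3|c₁|}`
at `9 ∣ N` (`natAbs_maninConstant₀_eq_or_eq_three_mul_of_nine_dvd_level`, ČNS Lemma 6.5 + Ling–Oesterlé) minus tripling.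
[cite: CesnaviciusNeururerSaha2023, Lemma 6.5] [cite: LingOesterle1991, Thm. 6] -/
theorem natAbs_maninConstant₀_eq_of_IIIstar_nine_mul_prime {p : ℕ} (hp : p.Prime) (hp3 : p % 3 = 2)
    [NeZero (9 * p)] (D₁ : Gamma1ParametrizationData W₁ (9 * p)) (D₀ : ModularParametrizationData W₀ (9 * p))
    (hiso : IsIsogenous W₁ W₀) (h₁ : D₁.IsOptimal)
    (h₀ : ∀ z ∈ D₀.L.lattice, ∃ w ∈ periodLattice D₀.f, z = D₀.c * w)
    (h9 : 3 ^ 2 ∣ W₀.conductorNorm ℤ) (h27 : ¬ 3 ^ 3 ∣ W₀.conductorNorm ℤ)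
    (hΔ : padicValInt 3 W₀.minimalDiscriminantInt = 9) (hj : 0 ≤ padicValRat 3 W₀.j) :
    D₀.maninConstant.natAbs = D₁.maninConstant.natAbs :=
  (natAbs_maninConstant₀_eq_or_eq_three_mul_of_nine_dvd_level D₁ D₀ hiso h₁ h₀ ⟨p, rfl⟩).resolve_right
    (natAbs_maninConstant₀_ne_three_mul_of_IIIstar_nine_mul_prime hp hp3 D₁ D₀ hiso h₁ h₀ h9 h27 hΔ hj)

/-- **`ℓ ∣ c₀ ⟺ ℓ ∣ c₁` on the `III*` stratum at `N = 9p`** (`p ≡ 2 (mod 3)`), for every integer `ℓ`.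
[cite: CesnaviciusNeururerSaha2023, Lemma 6.5] -/
theorem dvd_maninConstant₀_iff_of_IIIstar_nine_mul_prime {p : ℕ} (hp : p.Prime) (hp3 : p % 3 = 2)
    [NeZero (9 * p)] (D₁ : Gamma1ParametrizationData W₁ (9 * p)) (D₀ : ModularParametrizationData W₀ (9 * p))
    (hiso : IsIsogenous W₁ W₀) (h₁ : D₁.IsOptimal)
    (h₀ : ∀ z ∈ D₀.L.lattice, ∃ w ∈ periodLattice D₀.f, z = D₀.c * w)
    (h9 : 3 ^ 2 ∣ W₀.conductorNorm ℤ) (h27 : ¬ 3 ^ 3 ∣ W₀.conductorNorm ℤ)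
    (hΔ : padicValInt 3 W₀.minimalDiscriminantInt = 9) (hj : 0 ≤ padicValRat 3 W₀.j) (ℓ : ℤ) :
    ℓ ∣ D₀.maninConstant ↔ ℓ ∣ D₁.maninConstant := by
  have heq := natAbs_maninConstant₀_eq_of_IIIstar_nine_mul_prime hp hp3 D₁ D₀ hiso h₁ h₀ h9 h27 hΔ hj
  rw [← Int.natAbs_dvd_natAbs, ← Int.natAbs_dvd_natAbs (b := D₁.maninConstant), heq]

/-- **C3 on the optimal curve ⟺ Stevens' form `3 ∤ c₁`, on the `III*` stratum at `N = 9p`** (`p ≡ 2 (mod 3)`).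
[cite: CesnaviciusNeururerSaha2023, Lemma 6.5] [cite: Stevens1989, (5.2)–(5.4)] -/
theorem not_three_dvd_maninConstant₀_iff_of_IIIstar_nine_mul_prime {p : ℕ} (hp : p.Prime) (hp3 : p % 3 = 2)
    [NeZero (9 * p)] (D₁ : Gamma1ParametrizationData W₁ (9 * p)) (D₀ : ModularParametrizationData W₀ (9 * p))
    (hiso : IsIsogenous W₁ W₀) (h₁ : D₁.IsOptimal)
    (h₀ : ∀ z ∈ D₀.L.lattice, ∃ w ∈ periodLattice D₀.f, z = D₀.c * w)
    (h9 : 3 ^ 2 ∣ W₀.conductorNorm ℤ) (h27 : ¬ 3 ^ 3 ∣ W₀.conductorNorm ℤ)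
    (hΔ : padicValInt 3 W₀.minimalDiscriminantInt = 9) (hj : 0 ≤ padicValRat 3 W₀.j) :
    ¬ (3 : ℤ) ∣ D₀.maninConstant ↔ ¬ (3 : ℤ) ∣ D₁.maninConstant :=
  (dvd_maninConstant₀_iff_of_IIIstar_nine_mul_prime hp hp3 D₁ D₀ hiso h₁ h₀ h9 h27 hΔ hj 3).not

/-! ### The tameness hypotheses read off the level (Modularity Theorem as hypothesis, as in the crux) -/

omit [W₀.IsGloballyMinimal] in
/-- At level `9p` (`p` prime, `p ≡ 2 (mod 3)`), granted `exists_isNewformOf`, the curve of an `X₀(9p)`-datum is tame at `3`: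
`9 ∥ N(W₀)` (`N(W₀) = 9p` by strong multiplicity one, `IsNewformOf.level_eq_conductorNorm_of_exists_isNewformOf`).
[cite: DiamondShurman2005, Thm. 8.8.3] -/
theorem nine_dvd_not_twentyseven_dvd_conductorNorm_of_level_nine_mul_prime (hnf : exists_isNewformOf) {p : ℕ}
    (hp : p.Prime) (hp3 : p % 3 = 2) [NeZero (9 * p)] (D₀ : ModularParametrizationData W₀ (9 * p)) :
    3 ^ 2 ∣ W₀.conductorNorm ℤ ∧ ¬ 3 ^ 3 ∣ W₀.conductorNorm ℤ := by
  have hN : 9 * p = W₀.conductorNorm ℤ := IsNewformOf.level_eq_conductorNorm_of_exists_isNewformOf hnf D₀.isNewformOf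
  rw [← hN]
  refine ⟨⟨p, rfl⟩, fun h ↦ ?_⟩
  have h3p : 3 ∣ p := by
    have h27 : 27 ∣ 9 * p := by simpa using h
    omega
  have := (Nat.prime_dvd_prime_iff_eq Nat.prime_three hp).mp h3p
  omega

/-- **No tripling / `|c₀| = |c₁|` on the `III*` stratum at level `9p`, hypotheses read off the level** (the crux's
Modularity hypothesis `exists_isNewformOf`; `ord₃ Δ_min(W₀) = 9`, `ord₃ j(W₀) ≥ 0`).
[cite: CesnaviciusNeururerSaha2023, Lemma 6.5] [cite: DiamondShurman2005, Thm. 8.8.3] -/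
theorem natAbs_maninConstant₀_eq_of_IIIstar_of_level_nine_mul_prime (hnf : exists_isNewformOf) {p : ℕ} (hp : p.Prime)
    (hp3 : p % 3 = 2) [NeZero (9 * p)] (D₁ : Gamma1ParametrizationData W₁ (9 * p))
    (D₀ : ModularParametrizationData W₀ (9 * p)) (hiso : IsIsogenous W₁ W₀) (h₁ : D₁.IsOptimal)
    (h₀ : ∀ z ∈ D₀.L.lattice, ∃ w ∈ periodLattice D₀.f, z = D₀.c * w)
    (hΔ : padicValInt 3 W₀.minimalDiscriminantInt = 9) (hj : 0 ≤ padicValRat 3 W₀.j) :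
    D₀.maninConstant.natAbs ≠ 3 * D₁.maninConstant.natAbs ∧
      D₀.maninConstant.natAbs = D₁.maninConstant.natAbs ∧
      (¬ (3 : ℤ) ∣ D₀.maninConstant ↔ ¬ (3 : ℤ) ∣ D₁.maninConstant) := by
  obtain ⟨h9, h27⟩ := nine_dvd_not_twentyseven_dvd_conductorNorm_of_level_nine_mul_prime hnf hp hp3 D₀
  exact ⟨natAbs_maninConstant₀_ne_three_mul_of_IIIstar_nine_mul_prime hp hp3 D₁ D₀ hiso h₁ h₀ h9 h27 hΔ hj,
    natAbs_maninConstant₀_eq_of_IIIstar_nine_mul_prime hp hp3 D₁ D₀ hiso h₁ h₀ h9 h27 hΔ hj,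
    not_three_dvd_maninConstant₀_iff_of_IIIstar_nine_mul_prime hp hp3 D₁ D₀ hiso h₁ h₀ h9 h27 hΔ hj⟩

end Summit.BirchSwinnertonDyer.BirchSwinnertonDyer.Theorems.ManinLocalTwoThree

end
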